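import Summits.KontsevichZagierPeriods.KontsevichZagierPeriods.Theses.UnfoldedStokes
import Literature.NumberTheory.Transcendental.KZCalculus

/-!
# Sketch (crux-ideate round 1, ideator 2): first-lemma signatures for crux `LegendreCubicForm`
(stmt-KontsevichZagierPeriods-3521, route UnfoldedStokes, rank 3)

Crux: for rational `e₁ < e₂ < e₃`, `P(x) = (x−e₁)(x−e₂)(x−e₃)`, the period rectangle
`R = (e₁,e₂) × (e₂,e₃)` with integrand `g(λ,μ) = (μ−λ)/√(|P(λ)|·|P(μ)|)` (value
`I₁⁰I₂¹ − I₂⁰I₁¹ = 2π`, Legendre's relation in single-curve form) is KZ-equivalent to `[ℝ, 2/(1+x²)]`.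

GEOMETRY shared by cards 1 and 2 (sphero-conal / confocal coordinates of `S²`, axis `e₃`):
`xᵢ² = (eᵢ−λ)(eᵢ−μ)/∏_{j≠i}(eᵢ−eⱼ)` puts `R` in bijection with the open positive octant and
`g dλ dμ = 4·dA_{S²}`.  Write
  `A(λ) = √((λ−e₁)(e₂−λ))`, `B(μ) = √((μ−e₁)(μ−e₂))`, `C(λ,μ) = √((e₃−λ)(e₃−μ))`, `s = √D₃`,
  `D₃ = (e₃−e₁)(e₃−e₂)`, so that `√(|P(λ)||P(μ)|) = A·B·C` and `g = (μ−λ)/(A B C)` on `R`.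

* Card 1 `confocal-hatbox`: ONE rule-(2) move `Λ(λ,μ) = (u,z) = (tan(azimuth), height)`
  `= ( √((e₃−e₁)(e₂−λ)(μ−e₂)/((e₃−e₂)(λ−e₁)(μ−e₁))) , √((e₃−λ)(e₃−μ)/D₃) )`, a bijection
  `R → (0,∞) × (0,1)` with `g = (4/(1+u²))∘Λ · |det DΛ|` (Archimedes' hat-box: `dA = dθ dz`);
  then ONE Newton–Leibniz move in `z` (primitive `4z/(1+u²)`) and the arctangent tail.
* Card 2 `pole-regularised-angular-certificate`: NO 2-dim change of variables. The algebraic pair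
  `M = −2B/(A(s+C))`, `N = 2A/(B(s+C))` (pull-back of the pole-regular area primitive `4(1−z)dθ`)
  satisfies `g = ∂_λ N − ∂_μ M` on `R`; `−∂_μ M ≥ 0` carries all of `2π` to the edge `μ = e₃` as the
  arc density `2/A(λ)`; `∂_λ N` is a coboundary with zero edge values. Two rule-(3) moves.
* Card 3 `rational-modulus-product-substitution`: the product substitution
  `(λ,μ) = (e₁+(e₂−e₁)s², e₃−(e₃−e₂)t²)` identifies `g` with `4·F_m(s,t)`, `F_m` the one-representation
  Legendre family of GaussManinCertificates.LegendreSector, at the RATIONAL modulus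
  `m = (e₂−e₁)/(e₃−e₁)`; hence 3521 ⟸ LegendreSector restricted to `m ∈ ℚ`.

Kernel-checked here (no sorry): the polynomial hearts `key_identity`, `sphere_identity`,
`certificate_heart`, `jacobian_heart_cleared`, `product_heart`, and `rationalModulus_of_sector`.
Every `def … : Prop` below elaborates; none of them is proved here.
-/

noncomputable section

set_option linter.dupNamespace false
set_option linter.unusedVariables false

open MeasureTheory Set
open Literature.NumberTheory.Transcendental
open Literature.NumberTheory.Transcendental.KZ

namespace Summit.KontsevichZagierPeriods.KontsevichZagierPeriods.Cruxes.LegendreCubicForm.Ideator2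

/-! ## §0 Vocabulary (the crux's pins, verbatim) -/

/-- The open period rectangle `R = (e₁,e₂) × (e₂,e₃)` (the crux's pinned left domain). -/
def rect (e₁ e₂ e₃ : ℚ) : Set (Fin 2 → ℝ) :=
  {x | (e₁ : ℝ) < x 0 ∧ x 0 < (e₂ : ℝ) ∧ (e₂ : ℝ) < x 1 ∧ x 1 < (e₃ : ℝ)}

/-- The crux integrand `(μ−λ)/√(|P(λ)|·|P(μ)|)`, verbatim from `Theses.UnfoldedStokes.LegendreCubicForm`. -/
def cruxIntegrand (e₁ e₂ e₃ : ℚ) (x : Fin 2 → ℝ) : ℝ :=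
  (x 1 - x 0) / Real.sqrt (|(x 0 - (e₁ : ℝ)) * (x 0 - (e₂ : ℝ)) * (x 0 - (e₃ : ℝ))| *
    |(x 1 - (e₁ : ℝ)) * (x 1 - (e₂ : ℝ)) * (x 1 - (e₃ : ℝ))|)

/-- The crux's pinned right-hand integrand `2/(1+x²)` on `ℝ` (value `2π`). -/
def twoArctan (x : Fin 1 → ℝ) : ℝ := 2 / (1 + x 0 ^ 2)

/-- `A(λ) = √((λ−e₁)(e₂−λ))` (positive on `(e₁,e₂)`, zero at both ends). -/
def Afun (e₁ e₂ : ℚ) (l : ℝ) : ℝ := Real.sqrt ((l - e₁) * (e₂ - l))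

/-- `B(μ) = √((μ−e₁)(μ−e₂))` (positive on `(e₂,e₃]`, zero at `μ = e₂`, increasing). -/
def Bfun (e₁ e₂ : ℚ) (m : ℝ) : ℝ := Real.sqrt ((m - e₁) * (m - e₂))

/-- `C(λ,μ) = √((e₃−λ)(e₃−μ))` (`= z·√D₃`, height of the sphere point times `√D₃`). -/
def Cfun (e₃ : ℚ) (l m : ℝ) : ℝ := Real.sqrt ((e₃ - l) * (e₃ - m))

/-- `s = √D₃`, `D₃ = (e₃−e₁)(e₃−e₂)` (a real algebraic constant, hence ℚ-definable). -/
def sConst (e₁ e₂ e₃ : ℚ) : ℝ := Real.sqrt (((e₃ : ℝ) - e₁) * ((e₃ : ℝ) - e₂))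

/-! ## §1 The polynomial hearts (PROVED) -/

/-- KEY IDENTITY behind both Jacobians: `A²(e₃−μ) + B²(e₃−λ) = (μ−λ)(D₃ − C²)`. -/
theorem key_identity (e₁ e₂ e₃ l m : ℝ) :
    (l - e₁) * (e₂ - l) * (e₃ - m) + (m - e₁) * (m - e₂) * (e₃ - l) =
      (m - l) * ((e₃ - e₁) * (e₃ - e₂) - (e₃ - l) * (e₃ - m)) := by
  ring

/-- THE SPHERE: with `xᵢ² = (eᵢ−λ)(eᵢ−μ)/∏_{j≠i}(eᵢ−eⱼ)`, `x₁² + x₂² + x₃² = 1` (cleared of the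
three denominators `D₁ = (e₂−e₁)(e₃−e₁)`, `D₂ = (e₂−e₁)(e₃−e₂)`, `D₃ = (e₃−e₁)(e₃−e₂)`). -/
theorem sphere_identity (e₁ e₂ e₃ l m : ℝ) :
    (l - e₁) * (m - e₁) * (e₃ - e₂) + (e₂ - l) * (m - e₂) * (e₃ - e₁) +
        (e₃ - l) * (e₃ - m) * (e₂ - e₁) = (e₂ - e₁) * (e₃ - e₁) * (e₃ - e₂) := by
  ring

/-- CARD 2, CERTIFICATE HEART (cleared form of `∂_λN − ∂_μM = g`). With `A² = (λ−e₁)(e₂−λ)`,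
`B² = (μ−e₁)(μ−e₂)`, `C² = (e₃−λ)(e₃−μ)`, `s² = D₃` one has
`∂_λ N = [(e₁+e₂−2λ)(s+C)C + A²(e₃−μ)]/(A B C (s+C)²)` and
`−∂_μ M = [(2μ−e₁−e₂)(s+C)C + B²(e₃−λ)]/(A B C (s+C)²)`; their sum is `(μ−λ)(s+C)²/(A B C (s+C)²) = g`
because of the numerator identity below. -/
theorem certificate_heart (e₁ e₂ e₃ l m A B C s : ℝ)
    (hA : A ^ 2 = (l - e₁) * (e₂ - l)) (hB : B ^ 2 = (m - e₁) * (m - e₂))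
    (hC : C ^ 2 = (e₃ - l) * (e₃ - m)) (hs : s ^ 2 = (e₃ - e₁) * (e₃ - e₂)) :
    ((e₁ + e₂ - 2 * l) * (s + C) * C + A ^ 2 * (e₃ - m)) +
        ((2 * m - e₁ - e₂) * (s + C) * C + B ^ 2 * (e₃ - l)) = (m - l) * (s + C) ^ 2 := by
  linear_combination (e₃ - m) * hA + (e₃ - l) * hB + (m - l) * hC - (m - l) * hs

/-- CARD 2, the certificate identity WITH divisions (field form): assuming the four square relations
and non-vanishing, `∂_λN − ∂_μM = (μ−λ)/(A B C)`, where the two derivative EXPRESSIONS are written out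
(`A′ = (e₁+e₂−2λ)/(2A)`, `B′ = (2μ−e₁−e₂)/(2B)`, `C_λ = −(e₃−μ)/(2C)`, `C_μ = −(e₃−λ)/(2C)`). -/
theorem certificate_field (e₁ e₂ e₃ l m A B C s : ℝ)
    (hA : A ^ 2 = (l - e₁) * (e₂ - l)) (hB : B ^ 2 = (m - e₁) * (m - e₂))
    (hC : C ^ 2 = (e₃ - l) * (e₃ - m)) (hs : s ^ 2 = (e₃ - e₁) * (e₃ - e₂))
    (hA0 : A ≠ 0) (hB0 : B ≠ 0) (hC0 : C ≠ 0) (hsC : s + C ≠ 0) :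
    (2 / B) * (((e₁ + e₂ - 2 * l) / (2 * A)) * (s + C) - A * (-(e₃ - m) / (2 * C))) / (s + C) ^ 2
      - (-(2 / A)) * (((2 * m - e₁ - e₂) / (2 * B)) * (s + C) - B * (-(e₃ - l) / (2 * C))) / (s + C) ^ 2
      = (m - l) / (A * B * C) := by
  have key := certificate_heart e₁ e₂ e₃ l m A B C s hA hB hC hs
  have h2 : (s + C) ^ 2 ≠ 0 := pow_ne_zero 2 hsC
  have e1 : (2 / B) * (((e₁ + e₂ - 2 * l) / (2 * A)) * (s + C) - A * (-(e₃ - m) / (2 * C))) / (s + C) ^ 2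
      = ((e₁ + e₂ - 2 * l) * (s + C) * C + A ^ 2 * (e₃ - m)) / (A * B * C * (s + C) ^ 2) := by
    field_simp
    ring
  have e2 : (-(2 / A)) * (((2 * m - e₁ - e₂) / (2 * B)) * (s + C) - B * (-(e₃ - l) / (2 * C))) / (s + C) ^ 2
      = -(((2 * m - e₁ - e₂) * (s + C) * C + B ^ 2 * (e₃ - l)) / (A * B * C * (s + C) ^ 2)) := by
    field_simp
    ring
  rw [e1, e2, sub_neg_eq_add, ← add_div, key]
  field_simp

/-- CARD 1, JACOBIAN HEART (cleared form). For `Λ = (u,z)`, `u = A B (e₃−e₁)/(s (λ−e₁)(μ−e₁))`,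
`z = C/s`, the partials are `u_λ = −u(e₂−e₁)/(2A²)`, `u_μ = u(e₂−e₁)/(2B²)`, `z_λ = −(e₃−μ)/(2sC)`,
`z_μ = −(e₃−λ)/(2sC)`, so `det DΛ = u(e₂−e₁)[(e₃−λ)B² + (e₃−μ)A²]/(4 s C A² B²)`
`= u(e₂−e₁)(μ−λ)(s²−C²)/(4 s C A² B²)` (by `key_identity`), and `det DΛ = (1+u²)(μ−λ)/(4ABC)` reduces to
THIS polynomial identity (it is `x₁² + x₂² = 1 − x₃²` cleared of denominators): -/
theorem jacobian_heart_cleared (e₁ e₂ e₃ l m : ℝ) :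
    (e₂ - e₁) * ((e₃ - e₁) * (e₃ - e₂) - (e₃ - l) * (e₃ - m)) =
      (e₃ - e₂) * (l - e₁) * (m - e₁) + (e₂ - l) * (m - e₂) * (e₃ - e₁) := by
  ring

/-- CARD 3, PRODUCT-SUBSTITUTION HEART: under `λ = e₁ + (e₂−e₁)s²`, `μ = e₃ − (e₃−e₂)t²` and with
`m = (e₂−e₁)/(e₃−e₁)` every linear factor of `P(λ)`, `P(μ)` and `μ − λ` factors through the Legendre
data `1 − s²`, `1 − m s²`, `1 − t²`, `1 − (1−m)t²` (so `g·|det| = 4F_m(s,t)` pointwise, see the card). -/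
theorem product_heart (e₁ e₂ e₃ s t : ℝ) (h31 : e₃ - e₁ ≠ 0) :
    (e₂ - (e₁ + (e₂ - e₁) * s ^ 2) = (e₂ - e₁) * (1 - s ^ 2)) ∧
    (e₃ - (e₁ + (e₂ - e₁) * s ^ 2) = (e₃ - e₁) * (1 - (e₂ - e₁) / (e₃ - e₁) * s ^ 2)) ∧
    ((e₃ - (e₃ - e₂) * t ^ 2) - e₂ = (e₃ - e₂) * (1 - t ^ 2)) ∧
    ((e₃ - (e₃ - e₂) * t ^ 2) - e₁ = (e₃ - e₁) * (1 - (1 - (e₂ - e₁) / (e₃ - e₁)) * t ^ 2)) ∧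
    ((e₃ - (e₃ - e₂) * t ^ 2) - (e₁ + (e₂ - e₁) * s ^ 2) =
        (e₃ - e₁) * (1 - (e₂ - e₁) / (e₃ - e₁) * s ^ 2 - (1 - (e₂ - e₁) / (e₃ - e₁)) * t ^ 2)) := by
  refine ⟨by ring, ?_, by ring, ?_, ?_⟩ <;> field_simp <;> ring

/-! ## §2 Card 1 `confocal-hatbox`: one change of variables flattens the Legendre 2-form -/

/-- Archimedes–Jacobi map `Λ(λ,μ) = (u,z)`: `u = x₂/x₁ = tan(azimuth)` and `z = x₃ = height` of the
sphero-conal point; explicitly `u = √((e₃−e₁)(e₂−λ)(μ−e₂)/((e₃−e₂)(λ−e₁)(μ−e₁)))`,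
`z = √((e₃−λ)(e₃−μ)/((e₃−e₁)(e₃−e₂)))`. Product form: `u = U(λ)V(μ)`, `z = Z₁(λ)Z₂(μ)`. -/
def hatBox (e₁ e₂ e₃ : ℚ) (x : Fin 2 → ℝ) : Fin 2 → ℝ :=
  ![Real.sqrt (((e₃ : ℝ) - e₁) * ((e₂ : ℝ) - x 0) * (x 1 - e₂) /
      ((((e₃ : ℝ) - e₂) * (x 0 - e₁)) * (x 1 - e₁))),
    Real.sqrt (((e₃ : ℝ) - x 0) * ((e₃ : ℝ) - x 1) / (((e₃ : ℝ) - e₁) * ((e₃ : ℝ) - e₂)))]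

/-- The flat target: the half-strip `{u > 0, 0 < z < 1}`. -/
def halfStrip : Set (Fin 2 → ℝ) := {w | 0 < w 0 ∧ 0 < w 1 ∧ w 1 < 1}

/-- The flat density `4/(1+u²)` (constant in `z`: "hat-box"). Value on the half-strip: `4·π/2 = 2π`. -/
def flatDensity (w : Fin 2 → ℝ) : ℝ := 4 / (1 + w 0 ^ 2)

/-- Explicit inverse of `Λ` (for `InjOn`/`SurjOn`): from `(u,z)` put `x₁² = (1−z²)/(1+u²)`, `x₂² = u²x₁²`,
`x₃² = z²`; then `λ+μ = Σeᵢ − Σxᵢ²eᵢ`, `λμ = Σᵢ xᵢ² ∏_{j≠i} eⱼ`, and `λ < μ` are the two roots. -/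
def hatBoxInv (e₁ e₂ e₃ : ℚ) (w : Fin 2 → ℝ) : Fin 2 → ℝ :=
  let x1s : ℝ := (1 - w 1 ^ 2) / (1 + w 0 ^ 2)
  let x2s : ℝ := w 0 ^ 2 * x1s
  let x3s : ℝ := w 1 ^ 2
  let σ : ℝ := (e₁ + e₂ + e₃ : ℝ) - (x1s * e₁ + x2s * e₂ + x3s * e₃)
  let π' : ℝ := x1s * (e₂ * e₃ : ℝ) + x2s * (e₁ * e₃ : ℝ) + x3s * (e₁ * e₂ : ℝ)
  ![(σ - Real.sqrt (σ ^ 2 - 4 * π')) / 2, (σ + Real.sqrt (σ ^ 2 - 4 * π')) / 2]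

/-- `Λ` is a bijection of the open rectangle onto the open half-strip, with inverse `hatBoxInv`
(root location: `q(θ) = Σ xᵢ² ∏_{j≠i}(θ−eⱼ)` has `q(e₁) > 0 > q(e₂)`, `q(e₃) > 0`). -/
def HatBoxBijOn : Prop :=
  ∀ (e₁ e₂ e₃ : ℚ), e₁ < e₂ → e₂ < e₃ →
    BijOn (hatBox e₁ e₂ e₃) (rect e₁ e₂ e₃) halfStrip ∧
      InvOn (hatBoxInv e₁ e₂ e₃) (hatBox e₁ e₂ e₃) (rect e₁ e₂ e₃) halfStrip

/-- The pointwise pull-back identity `g = (4/(1+u²))∘Λ · |det DΛ|` on `R`, with the Jacobian written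
through the product form (`u_λ = −u(e₂−e₁)/(2(λ−e₁)(e₂−λ))`, `u_μ = u(e₂−e₁)/(2(μ−e₁)(μ−e₂))`,
`z_λ = −z/(2(e₃−λ))`, `z_μ = −z/(2(e₃−μ))`). Reduces to `jacobian_heart_cleared` + `key_identity`. -/
def HatBoxJacobian : Prop :=
  ∀ (e₁ e₂ e₃ : ℚ), e₁ < e₂ → e₂ < e₃ → ∀ x ∈ rect e₁ e₂ e₃,
    let u := hatBox e₁ e₂ e₃ x 0
    let z := hatBox e₁ e₂ e₃ x 1
    let uₗ := -u * ((e₂ : ℝ) - e₁) / (2 * (x 0 - e₁) * ((e₂ : ℝ) - x 0))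
    let uₘ := u * ((e₂ : ℝ) - e₁) / (2 * (x 1 - e₁) * (x 1 - e₂))
    let zₗ := -z / (2 * ((e₃ : ℝ) - x 0))
    let zₘ := -z / (2 * ((e₃ : ℝ) - x 1))
    cruxIntegrand e₁ e₂ e₃ x = flatDensity (hatBox e₁ e₂ e₃ x) * |uₗ * zₘ - uₘ * zₗ|

/-- **FIRST LEMMA of card 1 (`HatBoxTransfer`)**: ONE rule-(2) move takes the pinned crux
representation to the flat representation `[half-strip, 4/(1+u²)]`; witness `Φ = hatBox e₁ e₂ e₃`
(ℚ-semialgebraic: graph `u ≥ 0 ∧ u²(e₃−e₂)(λ−e₁)(μ−e₁) = (e₃−e₁)(e₂−λ)(μ−e₂) ∧ z ≥ 0 ∧ z²D₃ = (e₃−λ)(e₃−μ)`,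
polynomial over ℚ since `eᵢ ∈ ℚ`), `C^∞` and injective on the OPEN rectangle, image the half-strip. -/
def HatBoxTransfer : Prop :=
  ∀ (e₁ e₂ e₃ : ℚ), e₁ < e₂ → e₂ < e₃ → ∀ (r p : IntegralRep 2),
    r.domain = rect e₁ e₂ e₃ → EqOn r.integrand (cruxIntegrand e₁ e₂ e₃) r.domain →
    p.domain = halfStrip → EqOn p.integrand flatDensity p.domain →
    KZ.of r - KZ.of p ∈ changeOfVariablesRel

/-- HEIGHT INTEGRATION (`HeightNewtonLeibniz`): `[half-strip, 4/(1+u²)] ~ [(0,∞), 4/(1+u²)]` — null faces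
`z ∈ {0,1}` (domainAddRel + volume zero), then ONE `newtonLeibnizRel` instance along the last coordinate
with base `(0,∞)`, `a ≡ 0 ≤ b ≡ 1`, and the POLYNOMIAL-in-`z` primitive `F(u,z) = 4z/(1+u²)`. -/
def HeightNewtonLeibniz : Prop :=
  ∀ (p : IntegralRep 2) (q : IntegralRep 1), p.domain = halfStrip → EqOn p.integrand flatDensity p.domain →
    q.domain = {x | 0 < x 0} → EqOn q.integrand (fun x => 4 / (1 + x 0 ^ 2)) q.domain → Equivalent p q

/-- ARCTANGENT TAIL (`ArctanTailFour`, shared by all three cards): `[(0,∞), 4/(1+x²)] ~ [ℝ, 2/(1+x²)]` —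
integrand additivity `4 = 2 + 2`, reflection `x ↦ −x` of one copy onto `(−∞,0)`, domain additivity
`ℝ = (−∞,0) ∪ {0} ∪ (0,∞)` with the null point. Four bookkeeping moves, all data rational. -/
def ArctanTailFour : Prop :=
  ∀ (q r' : IntegralRep 1), q.domain = {x | 0 < x 0} → EqOn q.integrand (fun x => 4 / (1 + x 0 ^ 2)) q.domain →
    r'.domain = univ → EqOn r'.integrand twoArctan r'.domain → Equivalent q r'

/-- Shape of the intended `LegendreCubicForm_of` for crux-plan (three joints; recorded, not proved — the
composition needs the two intermediate representations to EXIST as `IntegralRep`s, i.e. semialgebraicity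
and integrability of `4/(1+u²)` on the half-strip and on `(0,∞)`, which is where a prover starts). -/
def hatbox_line_shape : Prop :=
  HatBoxTransfer → HeightNewtonLeibniz → ArctanTailFour →
    Summit.KontsevichZagierPeriods.KontsevichZagierPeriods.Theses.UnfoldedStokes.LegendreCubicForm

/-! ## §3 Card 2 `pole-regularised-angular-certificate`: two Newton–Leibniz moves, no 2-dim CoV -/

/-- `M(λ,μ) = −2·B(μ)/(A(λ)·(s + C(λ,μ)))` = the `dλ`-coefficient of `4(1−z)dθ` pulled back to `R`
(`θ` = azimuth about the `e₃`-axis, `z` = height). Vanishes on the edge `μ = e₂`; equals `−2/A(λ)` on `μ = e₃`;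
`μ ↦ M(λ,μ)` is continuous on `[e₂,e₃]` and DEcreasing. -/
def certM (e₁ e₂ e₃ : ℚ) (x : Fin 2 → ℝ) : ℝ :=
  -2 * Bfun e₁ e₂ (x 1) / (Afun e₁ e₂ (x 0) * (sConst e₁ e₂ e₃ + Cfun e₃ (x 0) (x 1)))

/-- `N(λ,μ) = 2·A(λ)/(B(μ)·(s + C(λ,μ)))` = the `dμ`-coefficient of `4(1−z)dθ` pulled back to `R`.
Vanishes on BOTH edges `λ = e₁`, `λ = e₂`; `λ ↦ N(λ,μ)` is continuous on `[e₁,e₂]`. -/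
def certN (e₁ e₂ e₃ : ℚ) (x : Fin 2 → ℝ) : ℝ :=
  2 * Afun e₁ e₂ (x 0) / (Bfun e₁ e₂ (x 1) * (sConst e₁ e₂ e₃ + Cfun e₃ (x 0) (x 1)))

/-- `g₊ = −∂_μ M ≥ 0` written out: `[(2μ−e₁−e₂)(s+C)C + B²(e₃−λ)] / (A B C (s+C)²)` (every factor positive on `R`;
it carries the whole value: `∫∫_R g₊ = ∫_{J₁} 2/A = 2π`). -/
def gPlus (e₁ e₂ e₃ : ℚ) (x : Fin 2 → ℝ) : ℝ :=
  ((2 * x 1 - e₁ - e₂) * (sConst e₁ e₂ e₃ + Cfun e₃ (x 0) (x 1)) * Cfun e₃ (x 0) (x 1) +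
      (x 1 - e₁) * (x 1 - e₂) * ((e₃ : ℝ) - x 0)) /
    (Afun e₁ e₂ (x 0) * Bfun e₁ e₂ (x 1) * Cfun e₃ (x 0) (x 1) * (sConst e₁ e₂ e₃ + Cfun e₃ (x 0) (x 1)) ^ 2)

/-- `g₀ = ∂_λ N` written out: `[(e₁+e₂−2λ)(s+C)C + A²(e₃−μ)] / (A B C (s+C)²)` (fibrewise a coboundary:
`∫_{J₁} g₀(λ,μ) dλ = N(e₂,μ) − N(e₁,μ) = 0` for every `μ`). -/
def gZero (e₁ e₂ e₃ : ℚ) (x : Fin 2 → ℝ) : ℝ :=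
  (((e₁ : ℝ) + e₂ - 2 * x 0) * (sConst e₁ e₂ e₃ + Cfun e₃ (x 0) (x 1)) * Cfun e₃ (x 0) (x 1) +
      (x 0 - e₁) * ((e₂ : ℝ) - x 0) * ((e₃ : ℝ) - x 1)) /
    (Afun e₁ e₂ (x 0) * Bfun e₁ e₂ (x 1) * Cfun e₃ (x 0) (x 1) * (sConst e₁ e₂ e₃ + Cfun e₃ (x 0) (x 1)) ^ 2)

/-- CERTIFICATE, pointwise (provable now from `certificate_heart` + `√`-algebra: `√(|P(λ)||P(μ)|) = A B C` on `R`):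
`g = g₊ + g₀` on `R`, together with the derivative facts `HasDerivAt (μ ↦ −M(λ,μ)) (g₊(λ,μ)) μ` and
`HasDerivAt (λ ↦ N(λ,μ)) (g₀(λ,μ)) λ` at interior points. -/
def CertificateSplit : Prop :=
  ∀ (e₁ e₂ e₃ : ℚ), e₁ < e₂ → e₂ < e₃ →
    (∀ x ∈ rect e₁ e₂ e₃, cruxIntegrand e₁ e₂ e₃ x = gPlus e₁ e₂ e₃ x + gZero e₁ e₂ e₃ x) ∧
    (∀ x ∈ rect e₁ e₂ e₃,
      HasDerivAt (fun t : ℝ => -certM e₁ e₂ e₃ ![x 0, t]) (gPlus e₁ e₂ e₃ x) (x 1)) ∧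
    (∀ x ∈ rect e₁ e₂ e₃,
      HasDerivAt (fun t : ℝ => certN e₁ e₂ e₃ ![t, x 1]) (gZero e₁ e₂ e₃ x) (x 0))

/-- On the rectangle, `√(|P(λ)|·|P(μ)|) = A(λ)·B(μ)·C(λ,μ)` (sign bookkeeping of the crux's absolute values). -/
theorem sqrt_absP_mul_absP (e₁ e₂ e₃ : ℚ) (x : Fin 2 → ℝ) (hx : x ∈ rect e₁ e₂ e₃) :
    Real.sqrt (|(x 0 - (e₁ : ℝ)) * (x 0 - (e₂ : ℝ)) * (x 0 - (e₃ : ℝ))| *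
        |(x 1 - (e₁ : ℝ)) * (x 1 - (e₂ : ℝ)) * (x 1 - (e₃ : ℝ))|) =
      Afun e₁ e₂ (x 0) * Bfun e₁ e₂ (x 1) * Cfun e₃ (x 0) (x 1) := by
  obtain ⟨h1, h2, h3, h4⟩ := hx
  have hx0e1 : 0 < x 0 - e₁ := sub_pos.2 h1
  have he2x0 : 0 < (e₂ : ℝ) - x 0 := sub_pos.2 h2
  have he3x0 : 0 < (e₃ : ℝ) - x 0 := by linarith
  have hx1e1 : 0 < x 1 - e₁ := by linarith
  have hx1e2 : 0 < x 1 - e₂ := sub_pos.2 h3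
  have he3x1 : 0 < (e₃ : ℝ) - x 1 := sub_pos.2 h4
  have ha : |(x 0 - (e₁ : ℝ)) * (x 0 - (e₂ : ℝ)) * (x 0 - (e₃ : ℝ))| =
      (x 0 - e₁) * ((e₂ - x 0) * (e₃ - x 0)) := by
    rw [show (x 0 - (e₁ : ℝ)) * (x 0 - (e₂ : ℝ)) * (x 0 - (e₃ : ℝ)) =
        (x 0 - e₁) * ((e₂ - x 0) * (e₃ - x 0)) by ring]
    exact abs_of_pos (mul_pos hx0e1 (mul_pos he2x0 he3x0))
  have hb : |(x 1 - (e₁ : ℝ)) * (x 1 - (e₂ : ℝ)) * (x 1 - (e₃ : ℝ))| =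
      (x 1 - e₁) * (x 1 - e₂) * (e₃ - x 1) := by
    rw [show (x 1 - (e₁ : ℝ)) * (x 1 - (e₂ : ℝ)) * (x 1 - (e₃ : ℝ)) =
        -((x 1 - e₁) * (x 1 - e₂) * (e₃ - x 1)) by ring, abs_neg]
    exact abs_of_pos (mul_pos (mul_pos hx1e1 hx1e2) he3x1)
  rw [ha, hb]
  unfold Afun Bfun Cfun
  rw [← Real.sqrt_mul (mul_pos hx0e1 he2x0).le, ← Real.sqrt_mul (by positivity)]
  congr 1
  ring

/-- **CERTIFICATE IDENTITY, PROVED POINTWISE ON THE RECTANGLE** (part (i) of `CertificateSplit`):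
`g = g₊ + g₀` with the explicit algebraic `g₊ = −∂_μM ≥ 0` and `g₀ = ∂_λN`. -/
theorem certificateSplit_pointwise (e₁ e₂ e₃ : ℚ) (x : Fin 2 → ℝ) (hx : x ∈ rect e₁ e₂ e₃) :
    cruxIntegrand e₁ e₂ e₃ x = gPlus e₁ e₂ e₃ x + gZero e₁ e₂ e₃ x := by
  have hx' := hx
  obtain ⟨h1, h2, h3, h4⟩ := hx
  have hx0e1 : 0 < x 0 - e₁ := sub_pos.2 h1
  have he2x0 : 0 < (e₂ : ℝ) - x 0 := sub_pos.2 h2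
  have he3x0 : 0 < (e₃ : ℝ) - x 0 := by linarith
  have hx1e1 : 0 < x 1 - e₁ := by linarith
  have hx1e2 : 0 < x 1 - e₂ := sub_pos.2 h3
  have he3x1 : 0 < (e₃ : ℝ) - x 1 := sub_pos.2 h4
  have he31 : 0 < (e₃ : ℝ) - e₁ := by linarith
  have he32 : 0 < (e₃ : ℝ) - e₂ := by linarith
  have hA2 : Afun e₁ e₂ (x 0) ^ 2 = (x 0 - e₁) * (e₂ - x 0) :=
    Real.sq_sqrt (mul_pos hx0e1 he2x0).le
  have hB2 : Bfun e₁ e₂ (x 1) ^ 2 = (x 1 - e₁) * (x 1 - e₂) :=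
    Real.sq_sqrt (mul_pos hx1e1 hx1e2).le
  have hC2 : Cfun e₃ (x 0) (x 1) ^ 2 = (e₃ - x 0) * (e₃ - x 1) :=
    Real.sq_sqrt (mul_pos he3x0 he3x1).le
  have hs2 : sConst e₁ e₂ e₃ ^ 2 = ((e₃ : ℝ) - e₁) * ((e₃ : ℝ) - e₂) :=
    Real.sq_sqrt (mul_pos he31 he32).le
  have hA0 : Afun e₁ e₂ (x 0) ≠ 0 := (Real.sqrt_pos.2 (mul_pos hx0e1 he2x0)).ne'
  have hB0 : Bfun e₁ e₂ (x 1) ≠ 0 := (Real.sqrt_pos.2 (mul_pos hx1e1 hx1e2)).ne'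
  have hC0 : Cfun e₃ (x 0) (x 1) ≠ 0 := (Real.sqrt_pos.2 (mul_pos he3x0 he3x1)).ne'
  have hsC : sConst e₁ e₂ e₃ + Cfun e₃ (x 0) (x 1) ≠ 0 :=
    (add_pos (Real.sqrt_pos.2 (mul_pos he31 he32)) (Real.sqrt_pos.2 (mul_pos he3x0 he3x1))).ne'
  have key := certificate_heart (e₁ : ℝ) e₂ e₃ (x 0) (x 1) (Afun e₁ e₂ (x 0)) (Bfun e₁ e₂ (x 1))
    (Cfun e₃ (x 0) (x 1)) (sConst e₁ e₂ e₃) hA2 hB2 hC2 hs2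
  have key2 : ((2 * x 1 - e₁ - e₂) * (sConst e₁ e₂ e₃ + Cfun e₃ (x 0) (x 1)) * Cfun e₃ (x 0) (x 1) +
        (x 1 - e₁) * (x 1 - e₂) * ((e₃ : ℝ) - x 0)) +
      (((e₁ : ℝ) + e₂ - 2 * x 0) * (sConst e₁ e₂ e₃ + Cfun e₃ (x 0) (x 1)) * Cfun e₃ (x 0) (x 1) +
        (x 0 - e₁) * ((e₂ : ℝ) - x 0) * ((e₃ : ℝ) - x 1)) =
      (x 1 - x 0) * (sConst e₁ e₂ e₃ + Cfun e₃ (x 0) (x 1)) ^ 2 := by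
    linear_combination key - ((e₃ : ℝ) - x 1) * hA2 - ((e₃ : ℝ) - x 0) * hB2
  have hABC : Afun e₁ e₂ (x 0) * Bfun e₁ e₂ (x 1) * Cfun e₃ (x 0) (x 1) ≠ 0 := by
    simp [hA0, hB0, hC0]
  have hden : Afun e₁ e₂ (x 0) * Bfun e₁ e₂ (x 1) * Cfun e₃ (x 0) (x 1) *
      (sConst e₁ e₂ e₃ + Cfun e₃ (x 0) (x 1)) ^ 2 ≠ 0 := mul_ne_zero hABC (pow_ne_zero 2 hsC)
  unfold cruxIntegrand gPlus gZero
  rw [sqrt_absP_mul_absP e₁ e₂ e₃ x hx', ← add_div, div_eq_div_iff hABC hden, key2]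
  ring

/-- **FIRST LEMMA of card 2 (`MuPrimitive`)**: ONE `newtonLeibnizRel` instance along `μ` (last coordinate)
on the closed-fibre band `J₁ × [e₂,e₃]` (`a ≡ e₂ ≤ b ≡ e₃`, base `J₁ = (e₁,e₂)`), primitive `F = −M`
(ℚ(√D₃)-semialgebraic, continuous on each closed fibre since `B(e₂) = 0` is approached continuously,
derivative `g₊` inside): `[J₁ × [e₂,e₃], g₊] − [J₁, 2/√((λ−e₁)(e₂−λ))] ∈ newtonLeibnizRel`
(`−M(λ,e₃) + M(λ,e₂) = 2/A(λ) + 0`). Integrability of `g₊` on the band: `g₊ ≥ 0` and the fibre integrals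
are `2/A(λ) ∈ L¹(J₁)` (Tonelli + FTC for monotone fibre functions). -/
def MuPrimitive : Prop :=
  ∀ (e₁ e₂ e₃ : ℚ), e₁ < e₂ → e₂ < e₃ → ∀ (r : IntegralRep 2) (r' : IntegralRep 1),
    r.domain = {x | (e₁ : ℝ) < x 0 ∧ x 0 < (e₂ : ℝ) ∧ (e₂ : ℝ) ≤ x 1 ∧ x 1 ≤ (e₃ : ℝ)} →
    EqOn r.integrand (gPlus e₁ e₂ e₃) r.domain →
    r'.domain = {x | (e₁ : ℝ) < x 0 ∧ x 0 < (e₂ : ℝ)} →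
    EqOn r'.integrand (fun x => 2 / Real.sqrt ((x 0 - e₁) * ((e₂ : ℝ) - x 0))) r'.domain →
    KZ.of r - KZ.of r' ∈ newtonLeibnizRel

/-- COBOUNDARY (`LambdaCoboundary`): after the coordinate swap (a rule-(2) permutation move), ONE
`newtonLeibnizRel` instance along `λ` on `J₂ × [e₁,e₂]` with primitive `N∘swap` (zero at both ends of every
fibre since `A(e₁) = A(e₂) = 0`): `[J₂ × [e₁,e₂], g₀∘swap] − [J₂, 0] ∈ newtonLeibnizRel`; and `[J₂, 0] ∈ relations`.
Integrability of `g₀`: `|g₀| ≤ (2/(B(μ)√D₃))·(|A′(λ)| + A(λ)|C_λ|/C)`, a product of one-variable L¹ majorants. -/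
def LambdaCoboundary : Prop :=
  ∀ (e₁ e₂ e₃ : ℚ), e₁ < e₂ → e₂ < e₃ → ∀ (r : IntegralRep 2) (r' : IntegralRep 1),
    r.domain = {x | (e₂ : ℝ) < x 0 ∧ x 0 < (e₃ : ℝ) ∧ (e₁ : ℝ) ≤ x 1 ∧ x 1 ≤ (e₂ : ℝ)} →
    EqOn r.integrand (fun x => gZero e₁ e₂ e₃ ![x 1, x 0]) r.domain →
    r'.domain = {x | (e₂ : ℝ) < x 0 ∧ x 0 < (e₃ : ℝ)} →
    EqOn r'.integrand (fun _ => 0) r'.domain →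
    KZ.of r - KZ.of r' ∈ newtonLeibnizRel

/-- ARC DENSITY (`ArcDensityTransfer`): the surviving edge term is a genus-0 period — ONE rational rule-(2)
move `Φ(x) = (e₂ + e₁x²)/(1+x²)` (injective on `(0,∞)`, image `(e₁,e₂)`, `|Φ′| = 2x(e₂−e₁)/(1+x²)²`,
`(λ−e₁)(e₂−λ) = (e₂−e₁)²x²/(1+x²)²`): `[(0,∞), 4/(1+x²)] − [J₁, 2/√((λ−e₁)(e₂−λ))] ∈ changeOfVariablesRel`. -/
def ArcDensityTransfer : Prop :=
  ∀ (e₁ e₂ : ℚ), e₁ < e₂ → ∀ (q r' : IntegralRep 1),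
    q.domain = {x | 0 < x 0} → EqOn q.integrand (fun x => 4 / (1 + x 0 ^ 2)) q.domain →
    r'.domain = {x | (e₁ : ℝ) < x 0 ∧ x 0 < (e₂ : ℝ)} →
    EqOn r'.integrand (fun x => 2 / Real.sqrt ((x 0 - e₁) * ((e₂ : ℝ) - x 0))) r'.domain →
    KZ.of q - KZ.of r' ∈ changeOfVariablesRel

/-- Shape of the intended `LegendreCubicForm_of` for card 2 (recorded, not proved; the glue is: rule (1b)
`[R,g] = [R,g₊] + [R,g₀]` via `CertificateSplit`, null edges `R ↔ J₁×[e₂,e₃]`, the swap, `[J₂,0] ∈ relations`). -/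
def certificate_line_shape : Prop :=
  CertificateSplit → MuPrimitive → LambdaCoboundary → ArcDensityTransfer → ArctanTailFour →
    Summit.KontsevichZagierPeriods.KontsevichZagierPeriods.Theses.UnfoldedStokes.LegendreCubicForm

/-! ## §4 Card 3 `rational-modulus-product-substitution`: the cubic rectangle IS the Legendre square at a rational modulus -/

/-- The one-representation Legendre family `F_m = κ_m ⊗ e_{1−m} + e_m ⊗ κ_{1−m} − κ_m ⊗ κ_{1−m}`, VERBATIM the
`F m x` of `Theses.GaussManinCertificates.LegendreSector` / `LegendreModulusPropagation` (stmt 3013 / 3014). -/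
def legendreF (m : ℝ) (x : Fin 2 → ℝ) : ℝ :=
  1 / Real.sqrt ((1 - x 0 ^ 2) * (1 - m * x 0 ^ 2)) * (Real.sqrt (1 - (1 - m) * x 1 ^ 2) / Real.sqrt (1 - x 1 ^ 2)) +
    Real.sqrt (1 - m * x 0 ^ 2) / Real.sqrt (1 - x 0 ^ 2) * (1 / Real.sqrt ((1 - x 1 ^ 2) * (1 - (1 - m) * x 1 ^ 2))) -
    1 / Real.sqrt ((1 - x 0 ^ 2) * (1 - m * x 0 ^ 2)) * (1 / Real.sqrt ((1 - x 1 ^ 2) * (1 - (1 - m) * x 1 ^ 2)))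

/-- The open unit square. -/
def sq : Set (Fin 2 → ℝ) := {x | ∀ i, x i ∈ Ioo (0 : ℝ) 1}

/-- The product substitution `Π(s,t) = (e₁ + (e₂−e₁)s², e₃ − (e₃−e₂)t²)` (polynomial over ℚ, diagonal Jacobian
`|det| = 4(e₂−e₁)(e₃−e₂)st`, a bijection `sq → R`). -/
def prodSub (e₁ e₂ e₃ : ℚ) (y : Fin 2 → ℝ) : Fin 2 → ℝ :=
  ![(e₁ : ℝ) + ((e₂ : ℝ) - e₁) * y 0 ^ 2, (e₃ : ℝ) - ((e₃ : ℝ) - e₂) * y 1 ^ 2]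

/-- **FIRST LEMMA of card 3 (`ProductSubstitution`)**: ONE rule-(2) move with the polynomial map `prodSub`:
`[sq, 4·F_m] − [R, g] ∈ changeOfVariablesRel`, `m = (e₂−e₁)/(e₃−e₁) ∈ ℚ ∩ (0,1)` — the pull-back is EXACT
pointwise: `g(Π(s,t))·4(e₂−e₁)(e₃−e₂)st = 4(1 − m s² − (1−m)t²)/(√(1−s²)√(1−ms²)√(1−t²)√(1−(1−m)t²)) = 4F_m(s,t)`
(`product_heart`). -/
def ProductSubstitution : Prop :=
  ∀ (e₁ e₂ e₃ : ℚ), e₁ < e₂ → e₂ < e₃ → ∀ (q r : IntegralRep 2),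
    q.domain = sq → EqOn q.integrand (fun y => 4 * legendreF (((e₂ - e₁) / (e₃ - e₁) : ℚ) : ℝ) y) q.domain →
    r.domain = rect e₁ e₂ e₃ → EqOn r.integrand (cruxIntegrand e₁ e₂ e₃) r.domain →
    KZ.of q - KZ.of r ∈ changeOfVariablesRel

/-- C⁺ RESTRICTED TO RATIONAL MODULI (`RationalModulusLegendre`): Legendre's relation in one-representation form
at every RATIONAL `m ∈ (0,1)`. It is `LegendreSector` (GaussManin crux 3013) specialised (proved below:
`rationalModulus_of_sector`), and it also follows from `LegendreModulusPropagation` (3014) + the PROVED CM anchor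
`GpcLegendreLemniscatic` (0280) + one swap-symmetrisation. Conversely `LegendreCubicForm` at `(0, m, 1)` gives it back. -/
def RationalModulusLegendre : Prop :=
  ∀ (m : ℚ), 0 < m → m < 1 → ∀ (q : IntegralRep 2) (r' : IntegralRep 1),
    q.domain = sq → EqOn q.integrand (legendreF (m : ℝ)) q.domain →
    r'.domain = univ → EqOn r'.integrand (fun x => 1 / (2 * (1 + x 0 ^ 2))) r'.domain → Equivalent q r'

/-- FOUR-FOLD BOOKKEEPING (`FourFold`): `[sq, 4F_m] − [ℝ, 2/(1+x²)] = 4·([sq, F_m] − [ℝ, 1/(2(1+x²))])` modulo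
six integrand-additivity moves (tree pattern `KZ.of_constMul_nat_sub_nsmul_mem_relations`). -/
def FourFold : Prop :=
  ∀ (m : ℚ), 0 < m → m < 1 →
    (∀ (q : IntegralRep 2) (r' : IntegralRep 1), q.domain = sq → EqOn q.integrand (legendreF (m : ℝ)) q.domain →
      r'.domain = univ → EqOn r'.integrand (fun x => 1 / (2 * (1 + x 0 ^ 2))) r'.domain → Equivalent q r') →
    ∀ (q : IntegralRep 2) (r' : IntegralRep 1),
      q.domain = sq → EqOn q.integrand (fun y => 4 * legendreF (m : ℝ) y) q.domain →
      r'.domain = univ → EqOn r'.integrand twoArctan r'.domain → Equivalent q r'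

/-- VERBATIM copy of `Theses.GaussManinCertificates.LegendreSector` (stmt-KontsevichZagierPeriods-3013), so that this
sketch does not import a second route module. -/
def LegendreSectorVerbatim : Prop :=
  ∀ (F : ℝ → (Fin 2 → ℝ) → ℝ), (∀ (m : ℝ) (x : Fin 2 → ℝ), F m x = 1 / Real.sqrt ((1 - x 0 ^ 2) * (1 - m * x 0 ^ 2)) * (Real.sqrt (1 - (1 - m) * x 1 ^ 2) / Real.sqrt (1 - x 1 ^ 2)) + Real.sqrt (1 - m * x 0 ^ 2) / Real.sqrt (1 - x 0 ^ 2) * (1 / Real.sqrt ((1 - x 1 ^ 2) * (1 - (1 - m) * x 1 ^ 2))) - 1 / Real.sqrt ((1 - x 0 ^ 2) * (1 - m * x 0 ^ 2)) * (1 / Real.sqrt ((1 - x 1 ^ 2) * (1 - (1 - m) * x 1 ^ 2)))) → ∀ (m : ℝ), IsAlgebraic ℚ m → m ∈ Set.Ioo (0 : ℝ) 1 → ∀ (r : Literature.NumberTheory.Transcendental.KZ.IntegralRep 2) (r' : Literature.NumberTheory.Transcendental.KZ.IntegralRep 1), r.domain = {x | ∀ i, x i ∈ Set.Ioo (0 :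 ℝ) 1} → Set.EqOn r.integrand (F m) r.domain → r'.domain = Set.univ → Set.EqOn r'.integrand (fun x => 1 / (2 * (1 + x 0 ^ 2))) r'.domain → Literature.NumberTheory.Transcendental.KZ.Equivalent r r'

/-- PROVED: the GaussManin crux `LegendreSector` (3013) implies the rational-modulus form used by card 3. -/
theorem rationalModulus_of_sector (h : LegendreSectorVerbatim) : RationalModulusLegendre := by
  intro m hm0 hm1 q r' hq hqi hr' hr'i
  have halg : IsAlgebraic ℚ ((m : ℚ) : ℝ) := by
    simpa using isAlgebraic_algebraMap (R := ℚ) (A := ℝ) m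
  have hmem : ((m : ℚ) : ℝ) ∈ Set.Ioo (0 : ℝ) 1 := ⟨by exact_mod_cast hm0, by exact_mod_cast hm1⟩
  exact h legendreF (fun _ _ => rfl) (m : ℝ) halg hmem q r' (by rw [hq]; rfl) hqi hr' hr'i

/-- Shape of the intended `LegendreCubicForm_of` for card 3 (recorded, not proved: needs the representation
`[sq, 4F_m]` to exist — semialgebraicity over ℚ and integrability of `F_m`, both patterns in tree for 3013/0280). -/
def transfer_line_shape : Prop :=
  ProductSubstitution → FourFold → RationalModulusLegendre →
    Summit.KontsevichZagierPeriods.KontsevichZagierPeriods.Theses.UnfoldedStokes.LegendreCubicForm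

/-! ## §5 Sanity examples -/

/-- The crux decl is reachable under the expected name (the `_of` theorems of crux-plan must conclude it BY NAME). -/
example : Summit.KontsevichZagierPeriods.KontsevichZagierPeriods.Theses.UnfoldedStokes.LegendreCubicForm =
    (∀ (e₁ e₂ e₃ : ℚ), e₁ < e₂ → e₂ < e₃ → ∀ (r : IntegralRep 2) (r' : IntegralRep 1),
      r.domain = {x | (e₁ : ℝ) < x 0 ∧ x 0 < (e₂ : ℝ) ∧ (e₂ : ℝ) < x 1 ∧ x 1 < (e₃ : ℝ)} →
      Set.EqOn r.integrand (fun x => (x 1 - x 0) / Real.sqrt (|(x 0 - (e₁ : ℝ)) * (x 0 - (e₂ : ℝ)) * (x 0 - (e₃ : ℝ))| *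
        |(x 1 - (e₁ : ℝ)) * (x 1 - (e₂ : ℝ)) * (x 1 - (e₃ : ℝ))|)) r.domain →
      r'.domain = Set.univ → Set.EqOn r'.integrand (fun x => 2 / (1 + x 0 ^ 2)) r'.domain → Equivalent r r') := rfl

/-- `rect`/`cruxIntegrand`/`twoArctan` are the crux's pins (definitional). -/
example (e₁ e₂ e₃ : ℚ) : rect e₁ e₂ e₃ = {x | (e₁ : ℝ) < x 0 ∧ x 0 < (e₂ : ℝ) ∧ (e₂ : ℝ) < x 1 ∧ x 1 < (e₃ : ℝ)} := rfl

end Summit.KontsevichZagierPeriods.KontsevichZagierPeriods.Cruxes.LegendreCubicForm.Ideator2
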